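import Summits.CriticalPhenomena.PercolationContinuityZ3.Theorems.SahiMasterFamilyHeredity

/-!
# The comparable-slot step of the master family: `C_k ⇒ C_{k+1}` on tuples with a comparable pair, every `k`

Companion of `SahiMasterFamily.lean` / `SahiMasterFamilyHeredity.lean` (crux `NoHeavyLowerTail`,
stmt-CriticalPhenomena-4575; cell `prim-masterthm`, unit `prim-masterthm-p4` = "induction on `k`").  Vocabulary as there:
Sahi's `E_k` = `Literature.Combinatorics.Sahi2008.sahiE` [Sahi2008; LiebSahi2021, Def. 3.1 / Prop. 3.3], product weight
`bernoulliWeight p`, indicator families `ind (U j)`, `MasterFamilyNonneg k` (= Sahi's `C_k` on product measures, OPEN for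
`k ≥ 3`), `MasterFamilyEqIff k` (our conjectured zero locus `Z_k = SuppZeroFlag k`, OPEN for `k ≥ 3`).

THE STEP (an upward rung of the "induction on `k`", proved for every `k`).  Peel the Lieb–Sahi recursion at a slot `i`
(`sahiE_peel`): `E_{n+2}(F) = Σ_l E_{n+1}(F_{−i}; F_l ↦ F_l·F_i) − E(F_i)·E_{n+1}(F_{−i})`.  If ONE of the other slots is
ABSORBED by `F_i` (`F_{l₀}·F_i = F_{l₀}` — for indicators: `U_{l₀} ⊆ U_i`), its modified family is `F_{−i}` itself, so
  `E_{n+2}(F) = Σ_{l ≠ l₀} E_{n+1}(F_{−i}; F_l ↦ F_l·F_i) + (1 − E F_i)·E_{n+1}(F_{−i})`      (`sahiE_peel_eq_of_absorbed`),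
a combination with NONNEGATIVE coefficients of `E_{n+1}`-values of sub/modified families (any weight, any functions; the
fully absorbing case `F_l·F_i = F_l ∀ l` is `Literature.Combinatorics.Sahi2008.sahiE_cons_of_absorbing`, and `F_i = 1` is
Sahi's branching [Sahi2008, Thm. 6]).  Consequences, for every order:
* `sahiE_ind_nonneg_of_subset` — GIVEN `MasterFamilyNonneg (k+2)`, every family of `k + 3` increasing events with a
  comparable pair `U_j ⊆ U_i` (`i ≠ j`) has `E_{k+3}(μ_p; 1_U) ≥ 0` (every `p ∈ [0,1]^ι`): **`C_{k+2} ⇒ C_{k+3}` on the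
  comparable stratum**; unconditionally (`k + 2 = 2`, Harris) `E_3 ≥ 0` for triples with a nested pair — the all-`k` form of
  `Literature.Probability.LatticeModels.sahiE3_nonneg_of_subset` / `…SahiE3UnionContainment`;
* `sahiE_ind_eq_zero_iff_of_subset` — GIVEN `MasterFamilyNonneg (k+2)` and `MasterFamilyEqIff (k+2)`, for `p` in the OPEN
  cube such a family has `E_{k+3} = 0 ↔ U ∈ Z_{k+3}`: **(EQ-(k+2)) ⇒ (EQ-(k+3)) on the comparable stratum** (heredity of zeros
  holds there, with the containing slot `i` as the peeled slot); unconditionally `(EQ-3)` for triples with a nested pair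
  (`sahiE_three_ind_eq_zero_iff_of_subset`), complementing the independent-pair stratum of `SahiMasterFamilyHeredity.lean`.
So the residual class of the `k`-induction (where `C_{k+1}` is NOT reduced to `C_k` by a proved identity) consists of
ANTICHAINS of events; see the unit's census (run/shared/lean/prim/prim-masterthm/MASTER-ROUTES.md §P4) for its size.
HONEST FRAMING: nothing here asserts `C_k` or (EQ-k) for `k ≥ 3`. [this work]
-/

noncomputable section

open scoped Classical

namespace Summit.CriticalPhenomena.PercolationContinuityZ3.Theorems

open Finset Function MeasureTheory
open Literature.Combinatorics.Sahi2008
open Literature.Probability.Percolation (DeterminedBy)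
open Literature.Probability.Percolation.DecisionTree (ind ind_of_mem ind_of_not_mem ind_nonneg)

/-! ### Abstract form: one absorbed slot -/

section Abstract

variable {α : Type*} [Fintype α]

/-- **Peeling at a slot that absorbs another one.**  If `F_{i.succAbove l₀} · F_i = F_{i.succAbove l₀}` then
`E_{n+2}(F) = Σ_{l ≠ l₀} E_{n+1}(F_{−i}; F_l ↦ F_l·F_i) + (1 − E F_i)·E_{n+1}(F_{−i})` (any weight, any functions).
[this work] -/
theorem sahiE_peel_eq_of_absorbed (μ : α → ℝ) (n : ℕ) (F : Fin (n + 2) → α → ℝ) (i : Fin (n + 2))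
    (l₀ : Fin (n + 1)) (habs : F (i.succAbove l₀) * F i = F (i.succAbove l₀)) :
    sahiE μ (n + 2) F =
      (∑ l ∈ univ.erase l₀, sahiE μ (n + 1)
          (update (fun j => F (i.succAbove j)) l (F (i.succAbove l) * F i))) +
        (1 - ex μ (F i)) * sahiE μ (n + 1) (fun j => F (i.succAbove j)) := by
  rw [sahiE_peel μ n F i, ← add_sum_erase _ _ (mem_univ l₀)]
  have h0 : update (fun j => F (i.succAbove j)) l₀ (F (i.succAbove l₀) * F i) = fun j => F (i.succAbove j) := by
    rw [habs]; exact update_eq_self l₀ _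
  rw [h0]
  ring

/-- Positivity form: with one absorbed slot, nonnegative `E_{n+1}`-values of the modified and deleted families and
`E F_i ≤ 1` give `E_{n+2}(F) ≥ 0`. [this work] -/
theorem sahiE_peel_nonneg_of_absorbed (μ : α → ℝ) (n : ℕ) (F : Fin (n + 2) → α → ℝ) (i : Fin (n + 2))
    (l₀ : Fin (n + 1)) (habs : F (i.succAbove l₀) * F i = F (i.succAbove l₀))
    (hmod : ∀ l, l ≠ l₀ → 0 ≤ sahiE μ (n + 1) (update (fun j => F (i.succAbove j)) l (F (i.succAbove l) * F i)))
    (hdel : 0 ≤ sahiE μ (n + 1) (fun j => F (i.succAbove j))) (hex : ex μ (F i) ≤ 1) :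
    0 ≤ sahiE μ (n + 2) F := by
  rw [sahiE_peel_eq_of_absorbed μ n F i l₀ habs]
  exact add_nonneg (sum_nonneg fun l hl => hmod l (ne_of_mem_erase hl)) (mul_nonneg (sub_nonneg.2 hex) hdel)

/-- Zero form: under the same sign information, `E_{n+2}(F) = 0` iff every modified family (`l ≠ l₀`) has `E_{n+1} = 0`
and `(1 − E F_i)·E_{n+1}(F_{−i}) = 0`. [this work] -/
theorem sahiE_peel_eq_zero_iff_of_absorbed (μ : α → ℝ) (n : ℕ) (F : Fin (n + 2) → α → ℝ) (i : Fin (n + 2))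
    (l₀ : Fin (n + 1)) (habs : F (i.succAbove l₀) * F i = F (i.succAbove l₀))
    (hmod : ∀ l, l ≠ l₀ → 0 ≤ sahiE μ (n + 1) (update (fun j => F (i.succAbove j)) l (F (i.succAbove l) * F i)))
    (hdel : 0 ≤ sahiE μ (n + 1) (fun j => F (i.succAbove j))) (hex : ex μ (F i) ≤ 1) :
    sahiE μ (n + 2) F = 0 ↔
      (∀ l, l ≠ l₀ → sahiE μ (n + 1) (update (fun j => F (i.succAbove j)) l (F (i.succAbove l) * F i)) = 0) ∧
        (1 - ex μ (F i)) * sahiE μ (n + 1) (fun j => F (i.succAbove j)) = 0 := by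
  rw [sahiE_peel_eq_of_absorbed μ n F i l₀ habs]
  have hs : 0 ≤ ∑ l ∈ univ.erase l₀, sahiE μ (n + 1)
      (update (fun j => F (i.succAbove j)) l (F (i.succAbove l) * F i)) :=
    sum_nonneg fun l hl => hmod l (ne_of_mem_erase hl)
  have hm : 0 ≤ (1 - ex μ (F i)) * sahiE μ (n + 1) (fun j => F (i.succAbove j)) :=
    mul_nonneg (sub_nonneg.2 hex) hdel
  rw [add_eq_zero_iff_of_nonneg hs hm, sum_eq_zero_iff_of_nonneg fun l hl => hmod l (ne_of_mem_erase hl)]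
  constructor
  · rintro ⟨h1, h2⟩
    exact ⟨fun l hl => h1 l (mem_erase.2 ⟨hl, mem_univ l⟩), h2⟩
  · rintro ⟨h1, h2⟩
    exact ⟨fun l hl => h1 l (ne_of_mem_erase hl), h2⟩

end Abstract

/-! ### Events under a product measure: the comparable stratum -/

section Events

variable {ι : Type*} [Fintype ι]

omit [Fintype ι] in
/-- Absorption for indicators: `U ⊆ V` gives `1_U · 1_V = 1_U`. [folklore] -/
theorem ind_mul_ind_eq_of_subset {U V : Set (Set ι)} (h : U ⊆ V) : ind U * ind V = ind U := by
  funext ω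
  rw [Pi.mul_apply, ← Literature.Probability.Percolation.BHK2006.ind_inter U V ω, Set.inter_eq_left.2 h]

/-- `E(1_V) ≤ 1` under a product weight. [folklore] -/
theorem ex_bernoulliWeight_ind_le_one (p : ι → unitInterval) (V : Set (Set ι)) :
    ex (bernoulliWeight p) (ind V) ≤ 1 := by
  rw [ex_bernoulliWeight_ind]; exact measureReal_le_one

/-- In the OPEN cube, `E(1_V) = 1` forces `V = univ` (every configuration has positive weight). [folklore] -/
theorem eq_univ_of_ex_ind_eq_one {p : ι → unitInterval} (hp : ∀ e, (p e : ℝ) ∈ Set.Ioo (0 : ℝ) 1)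
    {V : Set (Set ι)} (hV : ex (bernoulliWeight p) (ind V) = 1) : V = Set.univ := by
  have h1 : ∑ ω, bernoulliWeight p ω * (1 - ind V ω) = 0 := by
    simp only [mul_sub, mul_one, sum_sub_distrib, sum_bernoulliWeight p]
    rw [show ∑ ω, bernoulliWeight p ω * ind V ω = ex (bernoulliWeight p) (ind V) from rfl, hV, sub_self]
  have hnn : ∀ ω ∈ (univ : Finset (Set ι)), 0 ≤ bernoulliWeight p ω * (1 - ind V ω) := fun ω _ =>
    mul_nonneg (bernoulliWeight_pos hp ω).le (by
      by_cases hω : ω ∈ V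
      · rw [ind_of_mem hω]; norm_num
      · rw [ind_of_not_mem hω]; norm_num)
  rw [sum_eq_zero_iff_of_nonneg hnn] at h1
  ext ω
  simp only [Set.mem_univ, iff_true]
  by_contra hω
  have := h1 ω (mem_univ ω)
  rw [ind_of_not_mem hω, sub_zero, mul_one] at this
  exact (bernoulliWeight_pos hp ω).ne' this

/-- **`C_{k+2} ⇒ C_{k+3}` on the comparable stratum.**  GIVEN `MasterFamilyNonneg (k+2)`, a family of `k + 3` increasing
events in which slot `i` contains slot `i.succAbove l₀` has `E_{k+3}(μ_p; 1_U) ≥ 0` for every `p ∈ [0,1]^ι`. [this work] -/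
theorem sahiE_ind_nonneg_of_subset {k : ℕ} (hN : MasterFamilyNonneg (k + 2)) {ι : Type} [Fintype ι]
    (p : ι → unitInterval) (U : Fin (k + 3) → Set (Set ι)) (hU : ∀ j, IsUpperSet (U j)) (i : Fin (k + 3))
    (l₀ : Fin (k + 2)) (hsub : U (i.succAbove l₀) ⊆ U i) :
    0 ≤ sahiE (bernoulliWeight p) (k + 3) (fun j => ind (U j)) := by
  refine sahiE_peel_nonneg_of_absorbed (bernoulliWeight p) (k + 1) (fun j => ind (U j)) i l₀
    (ind_mul_ind_eq_of_subset hsub) (fun l _ => ?_) (hN ι p _ fun j => hU _) (ex_bernoulliWeight_ind_le_one p _)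
  rw [← ind_update_inter]
  exact hN ι p _ (isUpperSet_update_inter hU i l)

/-- The same with the comparable pair given as `U_j ⊆ U_i`, `i ≠ j`. [this work] -/
theorem sahiE_ind_nonneg_of_subset' {k : ℕ} (hN : MasterFamilyNonneg (k + 2)) {ι : Type} [Fintype ι]
    (p : ι → unitInterval) (U : Fin (k + 3) → Set (Set ι)) (hU : ∀ j, IsUpperSet (U j)) {i j : Fin (k + 3)}
    (hij : j ≠ i) (hsub : U j ⊆ U i) :
    0 ≤ sahiE (bernoulliWeight p) (k + 3) (fun j => ind (U j)) := by
  obtain ⟨l₀, hl₀⟩ := Fin.exists_succAbove_eq hij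
  exact sahiE_ind_nonneg_of_subset hN p U hU i l₀ (hl₀ ▸ hsub)

/-- **Unconditionally at order 3**: three increasing events with a nested pair have `E_3(μ_p) ≥ 0` for every `p ∈ [0,1]^ι`
(the all-`k` step at `k + 2 = 2`, Harris). [this work] -/
theorem sahiE_three_ind_nonneg_of_subset {ι : Type} [Fintype ι] (p : ι → unitInterval)
    (U : Fin 3 → Set (Set ι)) (hU : ∀ j, IsUpperSet (U j)) {i j : Fin 3} (hij : j ≠ i) (hsub : U j ⊆ U i) :
    0 ≤ sahiE (bernoulliWeight p) 3 (fun j => ind (U j)) :=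
  sahiE_ind_nonneg_of_subset' (masterFamilyNonneg_of_le_two le_rfl) p U hU hij hsub

/-- **(EQ-(k+2)) ⇒ (EQ-(k+3)) on the comparable stratum (heredity of zeros there).**  GIVEN `MasterFamilyNonneg (k+2)` and
`MasterFamilyEqIff (k+2)`, for `p` in the open cube a family of `k + 3` increasing events with `U_{i.succAbove l₀} ⊆ U_i` has
`E_{k+3}(μ_p; 1_U) = 0 ↔ U ∈ Z_{k+3}` — the zero flag being realised at the containing slot `i`. [this work] -/
theorem sahiE_ind_eq_zero_iff_of_subset {k : ℕ} (hN : MasterFamilyNonneg (k + 2)) (hE : MasterFamilyEqIff (k + 2))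
    {ι : Type} [Fintype ι] (p : ι → unitInterval) (hp : ∀ e, (p e : ℝ) ∈ Set.Ioo (0 : ℝ) 1)
    (U : Fin (k + 3) → Set (Set ι)) (hU : ∀ j, IsUpperSet (U j)) (i : Fin (k + 3)) (l₀ : Fin (k + 2))
    (hsub : U (i.succAbove l₀) ⊆ U i) :
    sahiE (bernoulliWeight p) (k + 3) (fun j => ind (U j)) = 0 ↔ SuppZeroFlag (k + 3) U := by
  refine ⟨fun h => ?_, fun h => masterFamilyEqIff_mpr (k + 3) ι p U h⟩
  have habs := ind_mul_ind_eq_of_subset hsub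
  have hmod : ∀ l : Fin (k + 2), l ≠ l₀ → 0 ≤ sahiE (bernoulliWeight p) (k + 2)
      (update (fun j => ind (U (i.succAbove j))) l (ind (U (i.succAbove l)) * ind (U i))) := fun l _ => by
    rw [← ind_update_inter]; exact hN ι p _ (isUpperSet_update_inter hU i l)
  have hdel : 0 ≤ sahiE (bernoulliWeight p) (k + 2) (fun j => ind (U (i.succAbove j))) := hN ι p _ fun j => hU _
  obtain ⟨h1, h2⟩ := (sahiE_peel_eq_zero_iff_of_absorbed (bernoulliWeight p) (k + 1) (fun j => ind (U j)) i l₀ habs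
    hmod hdel (ex_bernoulliWeight_ind_le_one p _)).1 h
  -- the modified event families, `l ≠ l₀`, are zero flags by (EQ-(k+2))
  have hZmod : ∀ l : Fin (k + 2), l ≠ l₀ →
      SuppZeroFlag (k + 2) (update (fun j => U (i.succAbove j)) l (U (i.succAbove l) ∩ U i)) := fun l hl => by
    refine (hE ι p hp _ (isUpperSet_update_inter hU i l)).1 ?_
    rw [ind_update_inter]; exact h1 l hl
  -- the absorbed slot: its modified family IS the deleted family
  have hfix : update (fun j => U (i.succAbove j)) l₀ (U (i.succAbove l₀) ∩ U i) = fun j => U (i.succAbove j) := by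
    rw [Set.inter_eq_left.2 hsub]; exact update_eq_self l₀ _
  -- the deleted family is a zero flag: either `P(U_i) < 1` kills it, or `U_i = univ` and any other slot is absorbed too
  have hZdel : SuppZeroFlag (k + 2) (fun j => U (i.succAbove j)) := by
    rcases mul_eq_zero.1 h2 with h3 | h3
    · have hV : U i = Set.univ := eq_univ_of_ex_ind_eq_one hp (sub_eq_zero.1 h3).symm
      obtain ⟨l₁, hl₁⟩ : ∃ l₁ : Fin (k + 2), l₁ ≠ l₀ := exists_ne l₀
      have := hZmod l₁ hl₁
      rwa [hV, Set.inter_univ, update_eq_self] at this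
    · exact (hE ι p hp _ fun j => hU _).1 h3
  refine ⟨i, hZdel, fun l => ?_⟩
  by_cases hl : l = l₀
  · rw [hl, hfix]; exact hZdel
  · exact hZmod l hl

/-- **Unconditionally at order 3**: for `p` in the open cube, three increasing events with a nested pair have
`E_3(μ_p) = 0 ↔ (Z)` (`Z_3`), by Harris and strict Harris — (EQ-3) on the comparable stratum. [this work] -/
theorem sahiE_three_ind_eq_zero_iff_of_subset {ι : Type} [Fintype ι] (p : ι → unitInterval)
    (hp : ∀ e, (p e : ℝ) ∈ Set.Ioo (0 : ℝ) 1) (U : Fin 3 → Set (Set ι)) (hU : ∀ j, IsUpperSet (U j))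
    (i : Fin 3) (l₀ : Fin 2) (hsub : U (i.succAbove l₀) ⊆ U i) :
    sahiE (bernoulliWeight p) 3 (fun j => ind (U j)) = 0 ↔ SuppZeroFlag 3 U :=
  sahiE_ind_eq_zero_iff_of_subset (masterFamilyNonneg_of_le_two le_rfl) masterFamilyEqIff_two p hp U hU i l₀ hsub

end Events

end Summit.CriticalPhenomena.PercolationContinuityZ3.Theorems
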